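import Summits.AtomisticToContinuum.HydrodynamicLimit.Theorems.TwoClocksEquilibriumFastWindowLDBirthT12DipoleT1B
import Summits.AtomisticToContinuum.HydrodynamicLimit.Theorems.TwoClocksEquilibriumFastWindowLDBirthT12EulerGrowthB
import HarnessLib

/-!
# T1/T2 in the dipole sector `ℓ = 1`, III: the two bootstrap rounds — log growth and the log-modulus of the
# dipole profile (helper `t12_dipole_T1` of the line `birth`, crux `TwoClocks.EquilibriumFastWindowLD`,
# stmt-AtomisticToContinuum-14440; §5 ASSEMBLY, sector `ℓ = 1`, of the registered analytic sub-goal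
# `t12_logLinearPreimage_and_dipoleModulus`)

Continuation of `…T12DipoleT1B` (notation from there). The unified defect bound `t12_dipole_eulerDefect` is run
twice:

* `norm_dipoleEulerDefect_le_log`, `dipole_round_one` — ROUND 1: a priori `‖Φ(t)‖ ≤ 12A(1+t)(1+log(1+t))` on
  `[1, ∞)` (lin-log class, `(1+s)² ≤ 4s²`), so `‖γ(s)‖ ≤ Γ₁(1 + log(1+s))`, `Γ₁ = (405984 + 2J₆)A + 2C_g`, and
  `euler_dipole_logSqGrowth` (`s₀ = 1`) gives `‖Φ(s)‖ ≤ 48A + 5Γ₁(1 + log(1+s))²` on `[1, ∞)`;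
* `logWeight_sq_le`, `logSqWeight_class`, `norm_dipoleEulerDefect_le_const` — ROUND 2: the squared-log class has
  polynomial increment `n = 2` and `(1 + log(1+s))²(1+s) ≤ 4(1+s)² ≤ 16s²`, so `γ` is BOUNDED on `[1, ∞)`:
  `‖γ(s)‖ ≤ Γ₂ = 135168 m₂ + (480 + 2J₆)A + 2C_g`, `m₂ = 48A + 5Γ₁`;
* `dipole_T1T2_profile` — `euler_dipole_norm_le` / `euler_dipole_logModulus` with the bounded defect:
  `‖Φ(s)‖ ≤ κ(A + C_g)(1 + log(1+s))` (`s ≥ 1`), `|⟪Φ(|x|), x⟫| ≤ κ(A + C_g)(1+|x|)(1 + log(1+|x|))` (all `x`),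
  `‖Φ(r) - Φ(S)‖ ≤ κ(A + C_g)(1 + log(S/r))` (`1 ≤ r ≤ S`), `κ = 2·10¹²(1 + J₆)` absolute;
* the registered **`t12_dipole_T1`** — for `ψ` continuous with `|ψ| ≤ A(1+|v|²)(1+log(1+|v|²))`, `ψ ⊥_M` the
  collision invariants, `Lψ = g` pointwise, `|g| ≤ C_g(1+|v|²)` (the conclusions of
  `t12_logQuadraticPreimage_of_quadraticData`, `A = C·C_g`): T1 in the sector `ℓ = 1`,
  `‖dipoleProfile ψ s‖ ≤ c(A + C_g)(1 + log(1+s))` (`s ≥ 1`), `|Π₁ψ(v)| ≤ c(A + C_g)(1+|v|)(1 + log(1+|v|))`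
  (all `v`), and T2, `‖dipoleProfile ψ r - dipoleProfile ψ S‖ ≤ c(A + C_g)(1 + log(S/r))` (`1 ≤ r ≤ S`) — along
  `Φ = dipoleProfile ψ` (`sectorEquation_dipolePart`, Z4 `t12_dipolePart_orthogonal_collisionInvariants`,
  `norm_dipoleProfile_le_radial`, `continuousOn_dipoleProfile`).

The `ℓ = 1` log-resonance is the true growth (T1 cannot be improved to `O(|v|)`); as `r → 0` no uniform modulus
holds for merely continuous data (`Φ(r)` may blow up like `r^{-1/2}`), whence `1 ≤ r`. [folklore] (Grad 1963 §4;
Cercignani–Illner–Pulvirenti 1994 §7.2; plan §5 of the line `birth`.)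
-/

noncomputable section

open MeasureTheory ProbabilityTheory Real Set Filter Metric
open scoped ENNReal BigOperators InnerProductSpace

namespace Summit.AtomisticToContinuum.HydrodynamicLimit.Theorems.ClampedCorrectorBirth

open Literature.Analysis.FluidPDE Literature.MathematicalPhysics.KineticTheory
open Literature.Analysis.UnboundedOperators Literature.Probability.Distributions

/-! ### Weights of the `ℓ = 1` bootstrap -/

/-- `(1 + log(1+s))² ≤ 4(1+s)` for `0 ≤ s` (`log x ≤ 2(√x - 1)`). [folklore] -/
theorem logWeight_sq_le {s : ℝ} (hs : 0 ≤ s) : (1 + Real.log (1 + s)) ^ 2 ≤ 4 * (1 + s) := by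
  have h1 : Real.log (Real.sqrt (1 + s)) ≤ Real.sqrt (1 + s) - 1 :=
    Real.log_le_sub_one_of_pos (Real.sqrt_pos.2 (by linarith))
  rw [Real.log_sqrt (by linarith)] at h1
  have h2 : Real.sqrt (1 + s) ^ 2 = 1 + s := Real.sq_sqrt (by linarith)
  have h3 : 1 ≤ Real.sqrt (1 + s) := by
    have := Real.sqrt_le_sqrt (by linarith : (1:ℝ) ≤ 1 + s)
    rwa [Real.sqrt_one] at this
  have h0 : 0 ≤ Real.log (1 + s) := Real.log_nonneg (by linarith)
  have h4 : 1 + Real.log (1 + s) ≤ 2 * Real.sqrt (1 + s) - 1 := by linarith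
  have h5 : (1 + Real.log (1 + s)) ^ 2 ≤ (2 * Real.sqrt (1 + s) - 1) ^ 2 :=
    pow_le_pow_left₀ (by linarith) h4 2
  nlinarith [h2, h3, h5]

/-- **The squared-log weight** `W(t) = (1 + log(1+t))²` is in the weight class of `…T12GainDipoleGrowthB` with
`n = 2`: nondecreasing and `≥ 1` on `[0, ∞)`, `W(s+t) ≤ W(s)(1+t)²` (square of `logWeight_class`). [folklore] -/
theorem logSqWeight_class :
    (∀ a b : ℝ, 0 ≤ a → a ≤ b → (1 + Real.log (1 + a)) ^ 2 ≤ (1 + Real.log (1 + b)) ^ 2) ∧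
      (∀ a : ℝ, 0 ≤ a → 1 ≤ (1 + Real.log (1 + a)) ^ 2) ∧
      ∀ s t : ℝ, 0 ≤ s → 0 ≤ t →
        (1 + Real.log (1 + (s + t))) ^ 2 ≤ (1 + Real.log (1 + s)) ^ 2 * (1 + t) ^ 2 := by
  obtain ⟨h1, h2, h3⟩ := logWeight_class
  refine ⟨fun a b ha hab => pow_le_pow_left₀ (zero_le_one.trans (h2 a ha)) (h1 a b ha hab) 2,
    fun a ha => one_le_pow₀ (h2 a ha), fun s t hs ht => ?_⟩
  rw [← mul_pow]
  have h := h3 s t hs ht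
  rw [pow_one] at h
  exact pow_le_pow_left₀ (zero_le_one.trans (h2 _ (by positivity))) h 2

/-! ### Round 1: the lin-log class has a log defect; squared-log growth -/

section Rounds

variable {Φ : ℝ → EuclideanSpace ℝ (Fin 3)} {A Cg : ℝ} {Gd : EuclideanSpace ℝ (Fin 3) → ℝ}

/-- **Round-1 defect.** A priori `‖Φ(t)‖ ≤ 12A(1+t)(1+log(1+t))` on `[1, ∞)` (lin-log class, `n = 2`), so
`t12_dipole_eulerDefect` gives `‖(4/s⁴)Ψ(s) - Φ(s)‖ ≤ Γ₁(1 + log(1+s))` on `[1, ∞)`,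
`Γ₁ = (405984 + 2J₆)A + 2C_g` (`8448·12·4 = 405504`, `(1+s)² ≤ 4s²`). [folklore] -/
theorem norm_dipoleEulerDefect_le_log (hΦm : Measurable Φ)
    (hΦA : ∀ s, 0 < s → s * ‖Φ s‖ ≤ 3 * A * ((1 + s ^ 2) * (1 + Real.log (1 + s ^ 2))))
    (horth : ∀ φ ∈ collisionInvariants (EuclideanSpace ℝ (Fin 3)),
      maxwellianInner (fun x : EuclideanSpace ℝ (Fin 3) => ⟪Φ ‖x‖, x⟫_ℝ) φ = 0)
    (hCg : 0 ≤ Cg) (hG : ∀ v : EuclideanSpace ℝ (Fin 3), |Gd v| ≤ 3 * Cg * (1 + ‖v‖ ^ 2))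
    (hS : ∀ v : EuclideanSpace ℝ (Fin 3), collisionFrequency v * ⟪Φ ‖v‖, v⟫_ℝ =
      gainTerm (fun x : EuclideanSpace ℝ (Fin 3) => ⟪Φ ‖x‖, x⟫_ℝ) v -
        lossTerm (fun x : EuclideanSpace ℝ (Fin 3) => ⟪Φ ‖x‖, x⟫_ℝ) v - Gd v)
    {s : ℝ} (hs : 1 ≤ s) :
    ‖(4 / s ^ 4) • (∫ t in (0:ℝ)..s, t ^ 3 • Φ t) - Φ s‖ ≤
      ((405984 + 2 * ∫ w, (1 + ‖w‖) ^ 6 ∂stdGaussian (EuclideanSpace ℝ (Fin 3))) * A + 2 * Cg) *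
        (1 + Real.log (1 + s)) := by
  obtain ⟨J, hJ0, hJ⟩ : ∃ J : ℝ, 0 ≤ J ∧ (∫ w, (1 + ‖w‖) ^ 6 ∂stdGaussian (EuclideanSpace ℝ (Fin 3))) = J :=
    ⟨_, integral_nonneg fun w => by positivity, rfl⟩
  obtain ⟨hA, -, -, -, hLL, -, -⟩ := dipoleField_apriori hΦA
  obtain ⟨w1, w2, w3⟩ := logLinearWeight_class
  have h := t12_dipole_eulerDefect Φ Gd _ A Cg (12 * A) hΦm hΦA horth w1 w2 w3 (by positivity) hLL hCg hG hS s hs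
  rw [hJ] at h ⊢
  refine h.trans ?_
  have hLg1 : 1 ≤ 1 + Real.log (1 + s) := one_le_one_add_log_one_add (by linarith)
  have h1 : (1 + s) * (1 + Real.log (1 + s)) * (1 + s) / s ^ 2 ≤ 4 * (1 + Real.log (1 + s)) := by
    rw [div_le_iff₀ (by positivity)]
    have : (1 + s) * (1 + s) ≤ 4 * s ^ 2 := by nlinarith
    nlinarith
  have hR0 : 0 ≤ (480 + 2 * J) * A + 2 * Cg := by positivity
  calc 8448 * (12 * A) * ((1 + s) * (1 + Real.log (1 + s)) * (1 + s) / s ^ 2) + ((480 + 2 * J) * A + 2 * Cg)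
      ≤ 8448 * (12 * A) * (4 * (1 + Real.log (1 + s))) + ((480 + 2 * J) * A + 2 * Cg) * (1 + Real.log (1 + s)) :=
        add_le_add (mul_le_mul_of_nonneg_left h1 (by positivity)) (le_mul_of_one_le_right hR0 hLg1)
    _ = ((405984 + 2 * J) * A + 2 * Cg) * (1 + Real.log (1 + s)) := by ring

/-- **Round 1 of the `ℓ = 1` bootstrap (squared-log growth).** Under the hypotheses of `t12_dipole_eulerDefect`
(a-priori class `A`, data `C_g`) and continuity of `Φ` on `(0, ∞)`: for `s ≥ 1`,
`‖Φ(s)‖ ≤ 48A + 5Γ₁(1 + log(1+s))²`, `Γ₁ = (405984 + 2J₆)A + 2C_g` — the log defect of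
`norm_dipoleEulerDefect_le_log` fed to `euler_dipole_logSqGrowth` (`s₀ = 1`, `‖Ψ(1)‖ ≤ 12A`). [folklore] -/
theorem dipole_round_one (hΦm : Measurable Φ) (hΦc : ContinuousOn Φ (Ioi 0))
    (hΦA : ∀ s, 0 < s → s * ‖Φ s‖ ≤ 3 * A * ((1 + s ^ 2) * (1 + Real.log (1 + s ^ 2))))
    (horth : ∀ φ ∈ collisionInvariants (EuclideanSpace ℝ (Fin 3)),
      maxwellianInner (fun x : EuclideanSpace ℝ (Fin 3) => ⟪Φ ‖x‖, x⟫_ℝ) φ = 0)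
    (hCg : 0 ≤ Cg) (hG : ∀ v : EuclideanSpace ℝ (Fin 3), |Gd v| ≤ 3 * Cg * (1 + ‖v‖ ^ 2))
    (hS : ∀ v : EuclideanSpace ℝ (Fin 3), collisionFrequency v * ⟪Φ ‖v‖, v⟫_ℝ =
      gainTerm (fun x : EuclideanSpace ℝ (Fin 3) => ⟪Φ ‖x‖, x⟫_ℝ) v -
        lossTerm (fun x : EuclideanSpace ℝ (Fin 3) => ⟪Φ ‖x‖, x⟫_ℝ) v - Gd v)
    {s : ℝ} (hs : 1 ≤ s) :
    ‖Φ s‖ ≤ 48 * A + 5 * ((405984 + 2 * ∫ w, (1 + ‖w‖) ^ 6 ∂stdGaussian (EuclideanSpace ℝ (Fin 3))) * A + 2 * Cg) *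
      (1 + Real.log (1 + s)) ^ 2 := by
  obtain ⟨hint, hI⟩ := cubeMoment_one_le hΦm hΦA
  have hγ : ∀ s, (1:ℝ) ≤ s → ‖(4 / s ^ 4) • (∫ t in (0:ℝ)..s, t ^ 3 • Φ t) - Φ s‖ ≤
      ((405984 + 2 * ∫ w, (1 + ‖w‖) ^ 6 ∂stdGaussian (EuclideanSpace ℝ (Fin 3))) * A + 2 * Cg) *
        (1 + Real.log (1 + s)) := fun s hs => norm_dipoleEulerDefect_le_log hΦm hΦA horth hCg hG hS hs
  have hE : ∀ s, (1:ℝ) ≤ s → Φ s = (4 / s ^ 4) • (∫ t in (0:ℝ)..s, t ^ 3 • Φ t) -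
      ((4 / s ^ 4) • (∫ t in (0:ℝ)..s, t ^ 3 • Φ t) - Φ s) := fun s _ => (sub_sub_cancel _ _).symm
  have h := (euler_dipole_logSqGrowth le_rfl hΦc hint hγ hE).1 s hs
  simp only [one_pow, div_one] at h
  linarith

/-! ### Round 2: the squared-log class has a bounded defect; T1 and T2 for the profile -/

/-- **Round-2 defect.** Once `‖Φ(t)‖ ≤ m₂(1 + log(1+t))²` on `[1, ∞)` (squared-log class, `n = 2`,
`logSqWeight_class`), the defect is BOUNDED: `‖(4/s⁴)Ψ(s) - Φ(s)‖ ≤ 135168 m₂ + (480 + 2J₆)A + 2C_g` on `[1, ∞)`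
(`(1 + log(1+s))²(1+s) ≤ 4(1+s)² ≤ 16s²`, `8448·16 = 135168`). [folklore] -/
theorem norm_dipoleEulerDefect_le_const (hΦm : Measurable Φ)
    (hΦA : ∀ s, 0 < s → s * ‖Φ s‖ ≤ 3 * A * ((1 + s ^ 2) * (1 + Real.log (1 + s ^ 2))))
    (horth : ∀ φ ∈ collisionInvariants (EuclideanSpace ℝ (Fin 3)),
      maxwellianInner (fun x : EuclideanSpace ℝ (Fin 3) => ⟪Φ ‖x‖, x⟫_ℝ) φ = 0)
    (hCg : 0 ≤ Cg) (hG : ∀ v : EuclideanSpace ℝ (Fin 3), |Gd v| ≤ 3 * Cg * (1 + ‖v‖ ^ 2))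
    (hS : ∀ v : EuclideanSpace ℝ (Fin 3), collisionFrequency v * ⟪Φ ‖v‖, v⟫_ℝ =
      gainTerm (fun x : EuclideanSpace ℝ (Fin 3) => ⟪Φ ‖x‖, x⟫_ℝ) v -
        lossTerm (fun x : EuclideanSpace ℝ (Fin 3) => ⟪Φ ‖x‖, x⟫_ℝ) v - Gd v)
    {m₂ : ℝ} (hm₂ : 0 ≤ m₂) (hΦ2 : ∀ t, 1 ≤ t → ‖Φ t‖ ≤ m₂ * (1 + Real.log (1 + t)) ^ 2)
    {s : ℝ} (hs : 1 ≤ s) :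
    ‖(4 / s ^ 4) • (∫ t in (0:ℝ)..s, t ^ 3 • Φ t) - Φ s‖ ≤
      135168 * m₂ + ((480 + 2 * ∫ w, (1 + ‖w‖) ^ 6 ∂stdGaussian (EuclideanSpace ℝ (Fin 3))) * A + 2 * Cg) := by
  obtain ⟨w1, w2, w3⟩ := logSqWeight_class
  have h := t12_dipole_eulerDefect Φ Gd _ A Cg m₂ hΦm hΦA horth w1 w2 w3 hm₂ hΦ2 hCg hG hS s hs
  refine h.trans (add_le_add ?_ le_rfl)
  have h1 : (1 + Real.log (1 + s)) ^ 2 * (1 + s) / s ^ 2 ≤ 16 := by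
    rw [div_le_iff₀ (by positivity)]
    have h2 := logWeight_sq_le (by linarith : (0:ℝ) ≤ s)
    have h3 : 4 * (1 + s) * (1 + s) ≤ 16 * s ^ 2 := by nlinarith
    nlinarith
  calc 8448 * m₂ * ((1 + Real.log (1 + s)) ^ 2 * (1 + s) / s ^ 2) ≤ 8448 * m₂ * 16 :=
        mul_le_mul_of_nonneg_left h1 (by positivity)
    _ = 135168 * m₂ := by ring

/-- **T1 and T2 in the dipole sector, profile form, constants linear in `A + C_g`.** Under the hypotheses of
`dipole_round_one` there is an absolute `κ` (`= 2·10¹²(1 + J₆)`) with: `‖Φ(s)‖ ≤ κ(A + C_g)(1 + log(1+s))` for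
`s ≥ 1` (T1, `ℓ = 1`); `|⟪Φ(‖x‖), x⟫| ≤ κ(A + C_g)(1+|x|)(1 + log(1+|x|))` for all `x`; and the LOG-MODULUS
`‖Φ(r) - Φ(S)‖ ≤ κ(A + C_g)(1 + log(S/r))` for `1 ≤ r ≤ S` (T2) — rounds 1 and 2, then `euler_dipole_norm_le` and
`euler_dipole_logModulus` with the bounded defect `Γ₂`. [folklore] -/
theorem dipole_T1T2_profile : ∃ κ : ℝ, 0 < κ ∧ ∀ (Φ : ℝ → EuclideanSpace ℝ (Fin 3))
    (Gd : EuclideanSpace ℝ (Fin 3) → ℝ) (A Cg : ℝ), Measurable Φ → ContinuousOn Φ (Ioi 0) →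
    (∀ s, 0 < s → s * ‖Φ s‖ ≤ 3 * A * ((1 + s ^ 2) * (1 + Real.log (1 + s ^ 2)))) →
    (∀ φ ∈ collisionInvariants (EuclideanSpace ℝ (Fin 3)),
      maxwellianInner (fun x : EuclideanSpace ℝ (Fin 3) => ⟪Φ ‖x‖, x⟫_ℝ) φ = 0) →
    0 ≤ Cg → (∀ v : EuclideanSpace ℝ (Fin 3), |Gd v| ≤ 3 * Cg * (1 + ‖v‖ ^ 2)) →
    (∀ v : EuclideanSpace ℝ (Fin 3), collisionFrequency v * ⟪Φ ‖v‖, v⟫_ℝ =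
      gainTerm (fun x : EuclideanSpace ℝ (Fin 3) => ⟪Φ ‖x‖, x⟫_ℝ) v -
        lossTerm (fun x : EuclideanSpace ℝ (Fin 3) => ⟪Φ ‖x‖, x⟫_ℝ) v - Gd v) →
    (∀ s, 1 ≤ s → ‖Φ s‖ ≤ κ * (A + Cg) * (1 + Real.log (1 + s))) ∧
    (∀ x : EuclideanSpace ℝ (Fin 3), |⟪Φ ‖x‖, x⟫_ℝ| ≤ κ * (A + Cg) * ((1 + ‖x‖) * (1 + Real.log (1 + ‖x‖)))) ∧
    ∀ r S : ℝ, 1 ≤ r → r ≤ S → ‖Φ r - Φ S‖ ≤ κ * (A + Cg) * (1 + Real.log (S / r)) := by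
  obtain ⟨J, hJ0, hJ⟩ : ∃ J : ℝ, 0 ≤ J ∧ (∫ w, (1 + ‖w‖) ^ 6 ∂stdGaussian (EuclideanSpace ℝ (Fin 3))) = J :=
    ⟨_, integral_nonneg fun w => by positivity, rfl⟩
  refine ⟨2 * 10 ^ 12 * (1 + J), by positivity, fun Φ Gd A Cg hΦm hΦc hΦA horth hCg hG hS => ?_⟩
  obtain ⟨hA, hdQ, -, -, -, hd12, -⟩ := dipoleField_apriori hΦA
  obtain ⟨hint, hI⟩ := cubeMoment_one_le hΦm hΦA
  have hU0 : 0 ≤ (1 + J) * (A + Cg) := by positivity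
  -- round 1
  have hr1 := fun t (ht : (1:ℝ) ≤ t) => dipole_round_one hΦm hΦc hΦA horth hCg hG hS ht
  simp only [hJ] at hr1
  set m₂ : ℝ := 48 * A + 5 * ((405984 + 2 * J) * A + 2 * Cg) with hm₂
  have hm₂0 : 0 ≤ m₂ := by positivity
  have hΦ2 : ∀ t, 1 ≤ t → ‖Φ t‖ ≤ m₂ * (1 + Real.log (1 + t)) ^ 2 := fun t ht => by
    have h := hr1 t ht
    have h1 : (1:ℝ) ≤ (1 + Real.log (1 + t)) ^ 2 := one_le_pow₀ (one_le_one_add_log_one_add (by linarith))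
    rw [hm₂, add_mul]
    nlinarith
  -- round 2
  set Γ₂ : ℝ := 135168 * m₂ + ((480 + 2 * J) * A + 2 * Cg) with hΓ₂
  have hγ : ∀ s, (1:ℝ) ≤ s → ‖(4 / s ^ 4) • (∫ t in (0:ℝ)..s, t ^ 3 • Φ t) - Φ s‖ ≤ Γ₂ := fun s hs => by
    have h := norm_dipoleEulerDefect_le_const hΦm hΦA horth hCg hG hS hm₂0 hΦ2 hs
    rwa [hJ] at h
  have hE : ∀ s, (1:ℝ) ≤ s → Φ s = (4 / s ^ 4) • (∫ t in (0:ℝ)..s, t ^ 3 • Φ t) -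
      ((4 / s ^ 4) • (∫ t in (0:ℝ)..s, t ^ 3 • Φ t) - Φ s) := fun s _ => (sub_sub_cancel _ _).symm
  have hΓ₂U : Γ₂ ≤ 275000000000 * ((1 + J) * (A + Cg)) := by
    rw [hΓ₂, hm₂]; nlinarith
  have hT1 : ∀ s, 1 ≤ s → ‖Φ s‖ ≤ 2 * 10 ^ 12 * (1 + J) * (A + Cg) * (1 + Real.log (1 + s)) := fun s hs => by
    have h := euler_dipole_norm_le one_pos hΦc hint hγ hE hs
    rw [one_pow, div_one, div_one] at h
    have hl1 : Real.log s ≤ Real.log (1 + s) := Real.log_le_log (by linarith) (by linarith)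
    have hl0 : 0 ≤ Real.log s := Real.log_nonneg hs
    have hAU : A ≤ (1 + J) * (A + Cg) := by nlinarith
    nlinarith [mul_le_mul_of_nonneg_right hΓ₂U hl0, mul_nonneg hU0 hl0]
  refine ⟨hT1, fun x => ?_, fun r S hr hrS => ?_⟩
  · rcases le_or_gt ‖x‖ 1 with hx | hx
    · have hw : (1:ℝ) ≤ (1 + ‖x‖) * (1 + Real.log (1 + ‖x‖)) := (one_add_le_linLog (norm_nonneg x)).2
      have hAU : A ≤ (1 + J) * (A + Cg) := by nlinarith
      calc |⟪Φ ‖x‖, x⟫_ℝ| ≤ 12 * A := hd12 x hx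
        _ ≤ 2 * 10 ^ 12 * (1 + J) * (A + Cg) * 1 := by nlinarith
        _ ≤ _ := mul_le_mul_of_nonneg_left hw (by positivity)
    · have h := hT1 ‖x‖ hx.le
      have hl : 0 ≤ 1 + Real.log (1 + ‖x‖) := by linarith [Real.log_nonneg (by linarith : (1:ℝ) ≤ 1 + ‖x‖)]
      calc |⟪Φ ‖x‖, x⟫_ℝ| ≤ ‖Φ ‖x‖‖ * ‖x‖ := abs_real_inner_le_norm _ _
        _ ≤ 2 * 10 ^ 12 * (1 + J) * (A + Cg) * (1 + Real.log (1 + ‖x‖)) * (1 + ‖x‖) :=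
            mul_le_mul h (by linarith) (norm_nonneg _) (by positivity)
        _ = _ := by ring
  · have h := euler_dipole_logModulus one_pos hΦc hint hγ hE hr hrS
    have hl0 : 0 ≤ Real.log (S / r) := Real.log_nonneg (by rw [le_div_iff₀ (by linarith)]; linarith)
    nlinarith [mul_le_mul_of_nonneg_right hΓ₂U hl0, mul_nonneg hU0 hl0]

end Rounds

/-! ### T1 and T2 in the dipole sector for a log-quadratic solution of `Lψ = g` -/

/-- **Registered helper `t12_dipole_T1` — T1 (log growth of the dipole profile) and T2 (its log-modulus) in the
sector `ℓ = 1`.** There is an absolute `c > 0` such that for every continuous `ψ` on `ℝ³` with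
`|ψ(v)| ≤ A(1+|v|²)(1+log(1+|v|²))`, `ψ ⊥_M` the collision invariants and `Lψ = g` pointwise with
`|g(v)| ≤ C_g(1+|v|²)` — the conclusions of `t12_logQuadraticPreimage_of_quadraticData` for the orthogonal pre-image
of admissible quadratic data, `A = C·C_g` — the dipole profile `Φ = dipoleProfile ψ` (`Π₁ψ(v) = ⟪Φ(|v|), v⟫`) has
`‖Φ(s)‖ ≤ c(A + C_g)(1 + log(1+s))` for `s ≥ 1`, `|Π₁ψ(v)| ≤ c(A + C_g)(1+|v|)(1 + log(1+|v|))` for all `v`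
(item T1 of `t12_logLinearPreimage_and_dipoleModulus` in the sector `ℓ = 1`: the `ℓ = 1` log-resonance is the
true growth), and `‖Φ(r) - Φ(S)‖ ≤ c(A + C_g)(1 + log(S/r))` for `1 ≤ r ≤ S` (item T2). Along the profile
`dipole_T1T2_profile` is met through `sectorEquation_dipolePart` (S1), Z4 `t12_dipolePart_orthogonal_collisionInvariants`,
`norm_dipoleProfile_le_radial`, `abs_dipolePart_le_radial`, `continuousOn_dipoleProfile`. [folklore] -/
theorem t12_dipole_T1 : ∃ c : ℝ, 0 < c ∧ ∀ (ψ g : EuclideanSpace ℝ (Fin 3) → ℝ) (A Cg : ℝ), Continuous ψ → (∀ v, |ψ v| ≤ A * (1 + ‖v‖ ^ 2) * (1 + Real.log (1 + ‖v‖ ^ 2))) → (∀ φ ∈ Literature.Analysis.UnboundedOperators.collisionInvariants (EuclideanSpace ℝ (Fin 3)), Literature.Analysis.UnboundedOperators.maxwellianInner ψ φ = 0) → (∀ v, Literature.Analysis.UnboundedOperators.hardSphereLinearizedOp ψ v = g v) → (∀ v, |g v| ≤ Cg * (1 + ‖v‖ ^ 2)) → (∀ s : ℝ, 1 ≤ s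 → ‖Summit.AtomisticToContinuum.HydrodynamicLimit.Theorems.ClampedCorrectorBirth.dipoleProfile ψ s‖ ≤ c * (A + Cg) * (1 + Real.log (1 + s))) ∧ (∀ v : EuclideanSpace ℝ (Fin 3), |inner ℝ (Summit.AtomisticToContinuum.HydrodynamicLimit.Theorems.ClampedCorrectorBirth.dipoleProfile ψ ‖v‖) v| ≤ c * (A + Cg) * ((1 + ‖v‖) * (1 + Real.log (1 + ‖v‖)))) ∧ ∀ r S : ℝ, 1 ≤ r → r ≤ S → ‖Summit.AtomisticToContinuum.HydrodynamicLimit.Theorems.ClampedCorrectorBirth.dipoleProfile ψ r - Summit.AtomisticToContinuum.HydrodynamicLimit.Theorems.ClampedCorrectorBirth.dipoleProfile ψ S‖ ≤ c * (A + Cg) * (1 + Real.log (S / r)) := by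
  obtain ⟨κ, hκ, hprof⟩ := dipole_T1T2_profile
  refine ⟨κ, hκ, fun ψ g A Cg hψc hψA horth hL hg => ?_⟩
  have hA0 : 0 ≤ A := by have h := hψA 0; norm_num at h; exact (abs_nonneg _).trans h
  have hCg : 0 ≤ Cg := by have h := hg 0; norm_num at h; exact (abs_nonneg _).trans h
  have hψm : Measurable ψ := hψc.measurable
  have hψG : ∀ x, |ψ x| ≤ 32 * A * Real.exp (‖x‖ ^ 2 / 4) := fun x => by
    calc |ψ x| ≤ A * (1 + ‖x‖ ^ 2) * (1 + Real.log (1 + ‖x‖ ^ 2)) := hψA x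
      _ = A * ((1 + ‖x‖ ^ 2) * (1 + Real.log (1 + ‖x‖ ^ 2))) := by ring
      _ ≤ A * (32 * Real.exp (‖x‖ ^ 2 / 4)) :=
          mul_le_mul_of_nonneg_left (quadLog_le_pow_four_and_exp ‖x‖).2 hA0
      _ = 32 * A * Real.exp (‖x‖ ^ 2 / 4) := by ring
  have hΦm : Measurable (dipoleProfile ψ) := by
    unfold dipoleProfile
    exact (by fun_prop : Measurable fun r : ℝ => 3 / (4 * Real.pi * r)).smul
      (continuous_integral_sphere_trace_smul hψc).measurable
  have hΦA : ∀ s, 0 < s → s * ‖dipoleProfile ψ s‖ ≤ 3 * A * ((1 + s ^ 2) * (1 + Real.log (1 + s ^ 2))) :=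
    fun s hs => by
      have h := norm_dipoleProfile_le_radial (W := fun r => A * (1 + r ^ 2) * (1 + Real.log (1 + r ^ 2))) hψA hs
      rw [le_div_iff₀ hs] at h
      linarith
  have hG : ∀ v, |dipolePart g v| ≤ 3 * Cg * (1 + ‖v‖ ^ 2) := fun v =>
    (abs_dipolePart_le_radial (ψ := g) (W := fun r => Cg * (1 + r ^ 2)) hg v).trans_eq (by ring)
  have hLg : hardSphereLinearizedOp ψ = g := funext hL
  have hS : ∀ v, collisionFrequency v * ⟪dipoleProfile ψ ‖v‖, v⟫_ℝ =
      gainTerm (fun x : EuclideanSpace ℝ (Fin 3) => ⟪dipoleProfile ψ ‖x‖, x⟫_ℝ) v -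
        lossTerm (fun x : EuclideanSpace ℝ (Fin 3) => ⟪dipoleProfile ψ ‖x‖, x⟫_ℝ) v - dipolePart g v := fun v => by
    have h := sectorEquation_dipolePart hψm hψG v
    rw [hLg] at h
    exact h
  exact hprof (dipoleProfile ψ) (dipolePart g) A Cg hΦm (continuousOn_dipoleProfile hψc) hΦA
    (t12_dipolePart_orthogonal_collisionInvariants ψ (32 * A) hψm hψG horth) hCg hG hS

end Summit.AtomisticToContinuum.HydrodynamicLimit.Theorems.ClampedCorrectorBirth

end
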